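import Literature.NumberTheory.EllipticCurves.Kobayashi2003.EtaColemanPoitouTateZetaSequences
import HarnessLib

/-!
# Kobayashi 2003, Thm. 6.2 (6.13)/(6.15) + Thm. 6.3 + Thm. 7.3 i) (7.21) + Cor. 7.2 at the quadratic
# character `η`, with `z` a genuine Euler-system class — the PRINT-EXACT reading of (7.21) on the pinned
# duals: `X^±(V/K_∞)^η` and `X⁰(V/K_∞)^η` with their CONTRAGREDIENT `Λ`-structure
# (`D : EtaSignedSelmerDualData V κ K₀ ℚ_[p] η γ⁻¹ ε`, `FB : W.FineSelmerDualData κ γ⁻¹` against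
# `I : Kato2004.IwasawaH1Data W p κ γ`)

Topic `NumberTheory/EllipticCurves`, sub-directory `Kobayashi2003` (namespace = path). Sibling of
`EtaColemanPoitouTateSequences` (hypothesis structure `EtaColemanPoitouTateData`, fact
`thm62_63_73_etaColemanPoitouTate`) and `EtaColemanPoitouTateZetaSequences` (extension
`EtaColemanPoitouTateZetaData` by the field `isEulerSystemClass_z`, PINNED fact
`thm62_63_73_etaColemanPoitouTate_zeta`, cell `bsd-potss`), whose vocabulary, fields and docstrings are
used unchanged except for the generator argument of the DUAL data. THIS FILE: two hypothesis STRUCTURES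
(`EtaColemanPoitouTateDataContra`: the fields of `EtaColemanPoitouTateData` VERBATIM, except that the
parameter `FB` and the Poitou–Tate fields `exact_plus` / `exact_minus` take the dual data with generator
argument `γ⁻¹`; `EtaColemanPoitouTateZetaDataContra`: `extends` it by the sibling's field
`isEulerSystemClass_z` verbatim) and ONE named CONSTRUCTION fact (`def … : Prop`, D-0014; nothing
asserted, no `_holds`): `thm62_63_73_etaColemanPoitouTate_zeta_contra`, the binders of
`thm62_63_73_etaColemanPoitouTate_zeta` VERBATIM except `FB : W.FineSelmerDualData κ γ⁻¹`. No instance,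
no notation, no attribute. Typed by a Literature typer (cell `bsd-stepL`, guest service) on the ARM-P
ticket «T-ι-ETA-ZETA-TWIN» (OPTIONAL TARGET #10, RELAY 51; source sheet
`pub/bsd-cited/sheets/D-AUDIT-r18-Q64-S3-IOTA-ADDENDUM.md`), discharging the TODO (lines 72–75) of
`SignedColemanKatoZetaContragredient.lean`. HONEST FRAMING: a TRANSCRIPTION; nothing of Kobayashi or Kato
is proved here; BSD is not proved by any of this; nothing is booked.

## The point (the `Λ`-module structure on the Pontryagin duals in (7.21) at `η`) — READING FLAG
## `Kob03-721-dual-action` (as in `SignedColemanKatoZetaContragredient`, `Kato-134-dual-action`)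

Kobayashi's (7.21) (p. 13) is an exact sequence of `Λ`-modules obtained from Poitou–Tate duality along
the tower ((7.17)–(7.20); Kato (14.9.3), (17.13.1) "a sequence of `Λ`-modules"), its `η`-component taken
here. Iwasawa cohomology `𝐇¹` carries the natural (covariant) action [Kato §12.2]; the tree pins it as
`I : Kato2004.IwasawaH1Data W p κ γ` with `T = conj_γ − 1` (`IwasawaH1Data.proj_T_smul`), and the
sibling's `colPlus`, `colMinus : I.H →ₗ[Λ] Λ` are `Λ`-linear for it. The duality pairings being
functorial, the duality maps carry the natural action to the CONTRAGREDIENT action `x ↦ x ∘ conj_{σ⁻¹}`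
on the Pontryagin duals `X = Hom(Sel, ℚ_p/ℤ_p)` (Def. 2.1, p. 5: "We denote the Pontryagin dual of
Selmer groups by "X""). The tree's dual data `EtaSignedSelmerDualData V κ K₀ ℚ_[p] η γ' ε`
(`CyclotomicTowerSignedSelmer.lean`, field `toDual_T_smul`: "`(T·x)(s) = x(conj_γ' s) − x(s)`") and
`W.FineSelmerDualData κ γ'` (`FineSelmerDualData.toDual_T_smul`) have `T` acting by PRE-composition with
`conj_{γ'}`, i.e. the contragredient action of `γ'⁻¹`; so with `1 + T ↦ γ` throughout, the
`η`-component of (7.21) is a sequence of `Λ`-LINEAR maps `I.H →^{col^ε} Λ → D.X → FB.X → 0` exactly for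
`D : EtaSignedSelmerDualData V κ K₀ ℚ_[p] η γ⁻¹ ε`, `FB : W.FineSelmerDualData κ γ⁻¹` — the fields
`exact_plus` / `exact_minus` below. The siblings quantify over `D`, `FB` with `γ` there (`(X^ε)^ι`,
`(X⁰)^ι` in Greenberg's notation `S^ι`, `ι(γ) = γ⁻¹` [Greenberg1989, pp. 101–102]), for which the printed
sequence gives `Λ`-linear maps out of `Λ` only after composing `col^ε` with `ι`; the two versions agree
iff the ideals `col^ε(𝐇¹) ⊆ Λ` are `ι`-symmetric — NOT in print (at `η ≠ 1` the printed symmetry is the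
functional equation of `L_p^{♯/♭}`, Sprung 2017 Cor. 4.14, which relates `L(T)` to `L(T^ι)` up to the
unit `(1+T)^c W^±` and a sign: a THEOREM to be used Summits-side, not an identity of ideals assumed
here). The fields `z`, `colPlus`, `colPlus_injective`, `isPlus_colPlus_z`, `colMinus`,
`colMinus_injective`, `isMinus_X_mul_colMinus_z`, `isEulerSystemClass_z` involve `𝐇¹` and `Λ` only and
are repeated VERBATIM; `isTorsion_fine` is the same sentence about `FB.X` (now over `γ⁻¹`). The siblings
are NOT edited (D-0014); this file vendors the print-exact reading under new names. All the siblings'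
reading flags (`Kob03-eta-twist-currency`, `Kob03-721-eta-maps-existential`, `Kob03-Thm74-eta-by-eta`,
`Kob03-Lpm-eta-upto-unit`, `Kob03-63-eta-ES-class`) apply verbatim.

## Source, verbatim (S. Kobayashi, Invent. Math. 152 (2003) 1–36 [Kobayashi2003]; the siblings'
## module docstrings quote §§2–7 in full)

Def. 2.1 (p. 5): "We denote the Pontryagin dual of Selmer groups by "X"." Thm. 7.3 (p. 13): "i) … we
have an exact sequence (7.21) `0 → 𝐇¹(T) → 𝐇¹_Iw(T)/𝐇¹_{Iw,±}(T) → X^±(E/K_∞) → X⁰(E/K_∞) → 0`."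
Cor. 7.2 (p. 13): `X⁰(E/K_∞)` is `Λ`-torsion. Thm. 6.3 (p. 11): "Let `z^± ∈ 𝐇¹(T)` be Kato's zeta
element in Theorem 5.2. Then `Col^±(z^∓)^η = η(−1) L_p^±(E, η, X)^η`." K. Kato, Astérisque 295, §12.2
(p. 220): "`𝐇¹(T)` and `𝐇²(T)` are finitely generated `ℤ_p[[G_∞]]`-modules"; §17.13 (p. 279): "we obtain
a sequence of `Λ`-modules (17.13.1)". R. Greenberg, Adv. Stud. Pure Math. 17 (1989) pp. 101–102: "If `S`
is any `Λ`-module, we define `S^ι` as the `Λ`-module with the same underlying set as `S` but with `Λ`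
acting through `ι`."

## What is NOT here (and why)

* NO edit of the siblings; NO claim that `EtaColemanPoitouTate(Zeta)Data` and the `…Contra` structures
  are equivalent (they differ by the unprinted `ι`-symmetry of `col^±(𝐇¹)`); NO conversion between them
  (the `γ ↦ γ⁻¹` twist of dual data, `exists_twist_etaSignedSelmerDualData_invol`, lives Summits-side).
* The unpinned sibling `thm62_63_73_etaColemanPoitouTate` gets NO twin here (ARM-P: the unpinned
  `η`-packages are verbatim by repackaging); the optional `EtaKatoColemanPoitouTateDataContra` /
  `thm52_…_contra` are not typed (no consumer named). Everything the siblings list under «NOT here»; no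
  `_holds` (size XL: Honda-theory Coleman maps, Kato's Euler system, Poitou–Tate along the tower).
-/

noncomputable section

open scoped Classical

open CongruenceSubgroup Polynomial WeierstrassCurve Field Literature.NumberTheory.EllipticCurves
  Literature.NumberTheory.EllipticCurves.ModularForms Literature.NumberTheory.GaloisRepresentations
  ZpExtension

namespace Literature.NumberTheory.EllipticCurves.Kobayashi2003

/-! ## §1 The hypothesis structures over the CONTRAGREDIENT duals -/

/-- **Kobayashi's Coleman / Poitou–Tate data at the quadratic character `η`, on pinned objects, with
the Pontryagin duals carrying their CONTRAGREDIENT `Λ`-structure** (hypothesis structure; nothing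
asserted by it). Parameters as in the sibling `EtaColemanPoitouTateData` except the pinned dual fine
Selmer datum `FB : W.FineSelmerDualData κ γ⁻¹` («`X⁰(V/K_∞)^η = X⁰(W/ℚ_∞)`» with `T = γ − 1` acting
contragrediently, flag `Kob03-721-dual-action`). Fields VERBATIM from the sibling — `z ∈ 𝐇¹`
(«`ε_η z_{η(−1)}`», Thm. 6.3; existential), Cor. 7.2 (`X⁰` torsion), for each sign `ε = ±1` an
INJECTIVE `Λ`-linear `col^ε : 𝐇¹ → Λ` (Thm. 6.2 (6.13)/(6.15), Thm. 7.3 i)) whose value at `z` is a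
plus function `L_p⁺(V, η, X)`, resp. `X⁻¹` times a minus function `L_p⁻(V, η, X)` (Thm. 6.3) — except
that the (7.21) fields quantify over the dual data `D : EtaSignedSelmerDualData V κ K₀ ℚ_[p] η γ⁻¹ ε`
of `Sel^ε(V/K_∞)^η`: some `Λ`-linear `Λ → X(D) → X⁰` make `𝐇¹ →^{col^ε} Λ → X(D) → X⁰ → 0` exact
((7.21) at `η`, arrows existential: flag `Kob03-721-eta-maps-existential`).
[cite: Kobayashi2003, Thm. 6.2 (6.13)–(6.15) and Thm. 6.3 (p. 11), Thm. 7.3 i) (7.21) and Cor. 7.2 (p. 13), Prop. 7.1 ii) (p. 12), §6 p. 11 (I = XΛ), (3.7) (p. 7), Def. 2.1 (p. 5)]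
[cite: Kato2004Asterisque, §12.2 (p. 220) and Thm. 12.4 (1) (p. 221) (the objects 𝐇¹, 𝐇² ≅ X⁰), §17.13 (17.13.1) (p. 279)]
[cite: Greenberg1989, pp. 101–102 (the Λ-module S^ι)] -/
structure EtaColemanPoitouTateDataContra (p : ℕ) [Fact p.Prime] (K₀ : Type) [Field K₀]
    [NumberField K₀] [(galRange (K := ℚ) K₀).Normal] (η : absoluteGaloisGroup ℚ →* ℤˣ)
    (V : WeierstrassCurve ℚ) [V.IsElliptic] {N : ℕ} (f : CuspForm (Gamma0 N) 2) (ϖ : ℚ)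
    (κ : ZpExtension ℚ p) (γ : absoluteGaloisGroup ℚ)
    (W : WeierstrassCurve ℚ) [W.IsElliptic] [ContinuousSMul ℤ_[p] (W.tateModule p)]
    (I : Kato2004.IwasawaH1Data W p κ γ) (FB : W.FineSelmerDualData κ γ⁻¹) where
  /-- «`ε_η z_{η(−1)}`»: the `η`-component of Kato's zeta element (Thm. 5.2 / Thm. 6.3), as an element
  of `𝐇¹_Γ(T_pW)`; existential. -/
  z : I.H
  /-- Cor. 7.2 at `η`: `X⁰(V/K_∞)^η = X⁰(W/ℚ_∞)` (contragredient structure) is `Λ`-torsion. -/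
  isTorsion_fine : Module.IsTorsion (IwasawaAlgebra p) FB.X
  /-- «`Col⁺ ∘ loc_𝔭`» on the `η`-component, through (6.13) `H¹_Iw(T)/H¹_{Iw,+}(T) ≃ Λ`. -/
  colPlus : I.H →ₗ[IwasawaAlgebra p] IwasawaAlgebra p
  /-- Thm. 7.3 i), sign `+`: `𝐇¹(T) → H¹_Iw(T)/H¹_{Iw,+}(T)` is injective. -/
  colPlus_injective : Function.Injective colPlus
  /-- Thm. 6.3, sign `+`, at `η`: `Col⁺(z_{η(−1)})^{ε_η} = η(−1)L_p⁺(E, η, X)ε_η` (up to `ℤ_pˣ`). -/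
  isPlus_colPlus_z : IsQuadraticBranchPlusLFunction f p ϖ (colPlus z)
  /-- (7.21), sign `+`, `η`-component, with (6.13), on the CONTRAGREDIENT duals:
  `𝐇¹ → Λ → X⁺(V/K_∞)^η → X⁰ → 0` exact and `Λ`-linear for `T = γ − 1`. -/
  exact_plus : ∀ D : EtaSignedSelmerDualData V κ K₀ ℚ_[p] η γ⁻¹ 1,
    ∃ (j : IwasawaAlgebra p →ₗ[IwasawaAlgebra p] D.X) (k : D.X →ₗ[IwasawaAlgebra p] FB.X),
      Function.Exact colPlus j ∧ Function.Exact j k ∧ Function.Surjective k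
  /-- «`X⁻¹ · (ε_η Col⁻ ∘ loc_𝔭)`», through (6.15) `H¹_Iw(T)^η/H¹_{Iw,−}(T)^η ≃ I^η = XΛ^η` and
  division by `X`. -/
  colMinus : I.H →ₗ[IwasawaAlgebra p] IwasawaAlgebra p
  /-- Thm. 7.3 i), sign `−`: `𝐇¹(T) → H¹_Iw(T)/H¹_{Iw,−}(T)` is injective. -/
  colMinus_injective : Function.Injective colMinus
  /-- Thm. 6.3, sign `−`, at `η ≠ 1`: `X · colMinus z` is a minus function `L_p⁻(V, η, X)` (up to
  `ℤ_pˣ`; (3.7): `X ∣ L_p⁻`). -/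
  isMinus_X_mul_colMinus_z : IsQuadraticBranchMinusLFunction f p ϖ (PowerSeries.X * colMinus z)
  /-- (7.21), sign `−`, `η`-component (`η ≠ 1`), with (6.15) and `I^η ≃ Λ^η`, on the CONTRAGREDIENT
  duals: `𝐇¹ → Λ → X⁻(V/K_∞)^η → X⁰ → 0` exact and `Λ`-linear for `T = γ − 1`. -/
  exact_minus : ∀ D : EtaSignedSelmerDualData V κ K₀ ℚ_[p] η γ⁻¹ (-1),
    ∃ (j : IwasawaAlgebra p →ₗ[IwasawaAlgebra p] D.X) (k : D.X →ₗ[IwasawaAlgebra p] FB.X),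
      Function.Exact colMinus j ∧ Function.Exact j k ∧ Function.Surjective k

/-- **The same data with `z` PINNED as a genuine Euler-system class of `T_pW`** (hypothesis structure;
nothing asserted by it — existence is the named fact `thm62_63_73_etaColemanPoitouTate_zeta_contra`).
It EXTENDS `EtaColemanPoitouTateDataContra p K₀ η V f ϖ κ γ W I FB` by the sibling's ONE field,
VERBATIM: `z` is the `Λ`-adic class of a GENUINE integral Euler system of `T_pW = T_pV ⊗ η` over the
cyclotomic levels (`Kato2004.IsEulerSystemClass W p κ γ I z`, a statement about `𝐇¹` only — unchanged
by the dual convention) — Thm. 6.3 "Let `z^± ∈ 𝐇¹(T)` be Kato's zeta element in Theorem 5.2" with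
Kato Ex. 13.3 / (8.1.3) and the twist reading (flag `Kob03-63-eta-ES-class`).
[cite: Kobayashi2003, Thm. 6.3 (p. 11), Thm. 5.2 and Remark 5.3 i) (pp. 9–10), Thm. 6.2 (6.13)–(6.15) (p. 11), Thm. 7.3 i) (7.21) and Cor. 7.2 (p. 13)]
[cite: Kato2004Asterisque, Ex. 13.3 (p. 225), (8.1.3) (p. 180), Thm. 12.6 (p. 222), §13.8 (p. 228)]
[cite: Rubin1998Durham, p. 360 (Euler systems for T_p(E) ⊗ χ)] -/
structure EtaColemanPoitouTateZetaDataContra (p : ℕ) [Fact p.Prime] (K₀ : Type) [Field K₀]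
    [NumberField K₀] [(galRange (K := ℚ) K₀).Normal] (η : absoluteGaloisGroup ℚ →* ℤˣ)
    (V : WeierstrassCurve ℚ) [V.IsElliptic] {N : ℕ} (f : CuspForm (Gamma0 N) 2) (ϖ : ℚ)
    (κ : ZpExtension ℚ p) (γ : absoluteGaloisGroup ℚ)
    (W : WeierstrassCurve ℚ) [W.IsElliptic] [ContinuousSMul ℤ_[p] (W.tateModule p)]
    [Module.Free ℤ_[p] (W.tateModule p)] [Module.Finite ℤ_[p] (W.tateModule p)]
    (I : Kato2004.IwasawaH1Data W p κ γ) (FB : W.FineSelmerDualData κ γ⁻¹)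
    extends EtaColemanPoitouTateDataContra p K₀ η V f ϖ κ γ W I FB where
  /-- Thm. 6.3 / Thm. 5.2 with Kato Ex. 13.3: `z` («`ε_η z_{η(−1)}`») is the `Λ`-adic class of a genuine
  integral Euler system of `T_pW = T_pV ⊗ η` (flag `Kob03-63-eta-ES-class`). -/
  isEulerSystemClass_z : Kato2004.IsEulerSystemClass W p κ γ I z

/-! ## §2 The named fact: the pinned structure over the contragredient duals is inhabited for every
`η`-frame -/

/-- **Kobayashi 2003, Thm. 6.2 (6.13)/(6.15) + Thm. 6.3 + Thm. 7.3 i) (7.21) + Cor. 7.2 at THE quadratic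
character `η = ω^{(p−1)/2}`, on pinned objects, WITH `z` a genuine Euler-system class of the twist, the
Pontryagin duals `X^±(V/K_∞)^η`, `X⁰(V/K_∞)^η` carrying their CONTRAGREDIENT `Λ`-structure (print-exact
reading of (7.21), flag `Kob03-721-dual-action`).** Binders VERBATIM from the sibling
`thm62_63_73_etaColemanPoitouTate_zeta` — `p` odd, `K₀ = ℚ(μ_p)`, `η : Γ_ℚ →* ℤˣ` trivial on
`Gal(ℚ̄/K₀)` and `≠ 1`, `V/ℚ` globally minimal with good reduction at `p` and `a_p(V) = 0`, newform `f`
of `V`, period ratio `ϖ` of the parity of `η`, cyclotomic `κ` with topological generator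
`γ ∈ Gal(ℚ̄/K₀)` matching the cyclotomic variable, every model `W/ℚ` of the quadratic twist of `V` by
`p* = (−1)^{⌊p/2⌋}p` (the three structure facts of `T_pW` are instance BINDERS), every pinned
`I : Kato2004.IwasawaH1Data W p κ γ` («`𝐇¹(T_pV)^η`») — EXCEPT the last: every pinned
`FB : W.FineSelmerDualData κ γ⁻¹` («`X⁰(V/K_∞)^η`», contragredient): then
`EtaColemanPoitouTateZetaDataContra p K₀ η V f ϖ κ γ W I FB` is inhabited — a GENUINE Euler-system class
`z ∈ 𝐇¹_Γ(T_pW)`, injective `Col^± ∘ loc : 𝐇¹ → Λ` with `(Col⁺∘loc)(z)` a plus function `L_p⁺(V, η, X)`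
and `X·(X⁻¹Col⁻∘loc)(z)` a minus function `L_p⁻(V, η, X)` (Thm. 6.2, 6.3, 7.3 i)), the `η`-components
of (7.21) exact for every CONTRAGREDIENT dual datum `D : EtaSignedSelmerDualData V κ K₀ ℚ_[p] η γ⁻¹ ε`
of `Sel^±(V/K_∞)^η`, and `X⁰` torsion (Cor. 7.2). The sibling (duals over `γ`) is NOT retired and is
NOT implied by or equivalent to this fact without the unprinted `ι`-symmetry of `col^±(𝐇¹)` (at `η`
the printed substitute is the functional equation of `L_p^{♯/♭}`, Sprung 2017 Cor. 4.14 — used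
Summits-side, not assumed here). Named fact; nothing asserted; no `_holds` (Coleman maps via Honda
theory §8, Kato's Euler system, Poitou–Tate along the tower: none of it is in Mathlib).
[cite: Kobayashi2003, Thm. 6.2 (6.13)–(6.15) and Thm. 6.3 (p. 11), Thm. 7.3 i) (7.21) and Cor. 7.2 (p. 13), Prop. 7.1 (p. 12), Thm. 5.1, Thm. 5.2 and Remark 5.3 i) (pp. 9–10), Thm. 3.2 and (3.4)–(3.7) (p. 7), §3 (p. 5), §4 (p. 8), Def. 2.1 (p. 5)]
[cite: Kato2004Asterisque, Ex. 13.3 (p. 225), (8.1.3) (p. 180), Thm. 12.5–12.6 (pp. 221–222), §12.2 (p. 220), §13.8 (p. 228), §17.13 (17.13.1) (p. 279)]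
[cite: Greenberg1989, pp. 101–102 (S^ι)] [cite: Rubin1998Durham, p. 360]
[cite: GreenbergLNM1716, §3 (prime-to-p descent; reading)] -/
def thm62_63_73_etaColemanPoitouTate_zeta_contra : Prop :=
  ∀ (p : ℕ) [Fact p.Prime] (K₀ : Type) [Field K₀] [NumberField K₀] [IsCyclotomicExtension {p} ℚ K₀]
    [(galRange (K := ℚ) K₀).Normal] (η : absoluteGaloisGroup ℚ →* ℤˣ),
    (∀ σ ∈ galRange (K := ℚ) K₀, η σ = 1) → η ≠ 1 →
  ∀ (V : WeierstrassCurve ℚ) [V.IsElliptic] [V.IsGloballyMinimal] {N : ℕ} [NeZero N]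
    {f : CuspForm (Gamma0 N) 2},
    p ≠ 2 → V.HasGoodReductionAtPrime p → V.frobeniusTrace p = 0 → IsNewformOf V f →
  ∀ (ϖ : ℚ), (if Even (p / 2) then (ϖ : ℝ) * V.realPeriodRat = plusPeriod f
      else (ϖ : ℝ) * V.imaginaryPeriodRat = minusPeriod f) →
  ∀ (κ : ZpExtension ℚ p) (γ : absoluteGaloisGroup ℚ),
    κ.IsCyclotomic → κ.IsTopGenerator γ → γ ∈ galRange (K := ℚ) K₀ → IsCyclotomicVariable p γ →
  ∀ (W : WeierstrassCurve ℚ) [W.IsElliptic] [ContinuousSMul ℤ_[p] (W.tateModule p)]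
    [Module.Free ℤ_[p] (W.tateModule p)] [Module.Finite ℤ_[p] (W.tateModule p)]
    (C : VariableChange ℚ), C • W.quadraticTwist ((-1) ^ (p / 2) * p) = V →
  ∀ (I : Kato2004.IwasawaH1Data W p κ γ) (FB : W.FineSelmerDualData κ γ⁻¹),
    Nonempty (EtaColemanPoitouTateZetaDataContra p K₀ η V f ϖ κ γ W I FB)

end Literature.NumberTheory.EllipticCurves.Kobayashi2003

end
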